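import Summits.NavierStokesRegularity.NavierStokesRegularity.Theorems.OddMorawetzLocal.Negative.OddMorawetzLocalB3Reduction
import Summits.NavierStokesRegularity.NavierStokesRegularity.Theorems.OddMorawetzMorawetzKillsTypeIDivFreeEulerBilinear
import Literature.Analysis.FluidPDE.TaoAveragedEulerContDiff

/-!
# `stub_nullTransfer`: total divergences have vanishing Euler derivative
  (crux `OddMorawetz.MorawetzKillsTypeI`, stmt-NavierStokesRegularity-1377, line `registered`)

Stub `stub_nullTransfer` of the lead's skeleton of the crux
`Summit.NavierStokesRegularity.NavierStokesRegularity.Theses.OddMorawetz.MorawetzKillsTypeI`.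

**Statement.** Let `n : Jet3 → ℝ` and `F : Jet3 → ℝ³` be smooth, and suppose that along every smooth
divergence-free field `w` the pulled-back density is a total divergence,
`n (J w x) = div_x [F (J w ·)] (x)` (`J` the 3-jet map). Then for every divergence-free Schwartz field `v`,
`∫ Dn(J v x)[J b x] dx = 0`, where `b = B(v,v)` is the Euler bilinear term.

**Proof (polarise, integrate, differentiate under the integral sign).**
* `b` is smooth with `(1+|x|)⁻⁴`-decaying jets of order `≤ 4` (the landed `stub_jetDecay`) and divergence
  free (the landed `stub_divFree_eulerBilinear`); `v` is smooth with Schwartz decay (`schwartz_decay_four`).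
* For every `t : ℝ` the field `w_t = v + t b` is smooth and divergence free (the divergence is linear), and
  `J w_t = J v + t J b` (linearity of `iteratedFDeriv`). Its jets of order `≤ 4` decay like `(A + |t| C)(1+|x|)⁻⁴`,
  so by the flux lemma of the landed `stub_fluxTransfer` file (`StubFluxTransfer.flux`: whole-space divergence
  theorem in `L¹` form) `x ↦ div_x[F(J w_t ·)](x)` is integrable with integral zero. By the hypothesis,
  `f(t) := ∫ n (J v x + t J b x) dx = 0` for all `t`.
* Differentiate under the integral sign at `t = 0` (Mathlib
  `hasDerivAt_integral_of_dominated_loc_of_deriv_le`): the `t`-derivative of the integrand is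
  `Dn(J v x + t J b x)[J b x]`, dominated for `|t| < 1` by `M C (1+|x|)⁻⁴` with `M` a bound of `Dn` on the
  compact closed ball of radius `A + C` of the (finite-dimensional) jet space. Hence
  `∫ Dn(J v x)[J b x] dx = f'(0) = 0`.

Helpers (namespace `…Theorems.NullTransfer`): linearity of the divergence and of the jets along `v + t b`, and
the core lemma `integral_fderiv_eq_zero` (with the jet map pinned by its defining equation).
No definitions, no named facts; everything proved.
-/

noncomputable section

-- the problem namespace `Summit.NavierStokesRegularity.NavierStokesRegularity` repeats the summit name by design
set_option linter.dupNamespace false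

namespace Summit.NavierStokesRegularity.NavierStokesRegularity.Theorems

open MeasureTheory Metric
open Literature.Analysis.FluidPDE
open Summit.NavierStokesRegularity.NavierStokesRegularity.Theorems.OddMorawetz

namespace NullTransfer

/-- **Linearity of the divergence** along the line `u + t w`: for differentiable fields,
`div (u + t w) = div u + t div w` (the trace and the Fréchet derivative are linear). -/
theorem divergence_add_smul {u w : E3 → E3} (hu : Differentiable ℝ u) (hw : Differentiable ℝ w) (t : ℝ)
    (x : E3) :
    VectorCalculus.divergence (fun y => u y + t • w y) x =
      VectorCalculus.divergence u x + t * VectorCalculus.divergence w x := by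
  unfold VectorCalculus.divergence
  have h : (fun y => u y + t • w y) = u + t • w := rfl
  rw [h, ((hu x).hasFDerivAt.add ((hw x).hasFDerivAt.const_smul t)).fderiv, ContinuousLinearMap.toLinearMap_add,
    ContinuousLinearMap.toLinearMap_smul, map_add, map_smul, smul_eq_mul]

/-- **Linearity of the jets** along the line `u + t w`: for smooth fields and every order `k`,
`Dᵏ(u + t w)(x) = Dᵏu(x) + t Dᵏw(x)` (Mathlib `iteratedFDeriv_add_apply`, `iteratedFDeriv_const_smul_apply`). -/
theorem iteratedFDeriv_add_smul {u w : E3 → E3} (hu : ContDiff ℝ (⊤ : ℕ∞) u) (hw : ContDiff ℝ (⊤ : ℕ∞) w)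
    (t : ℝ) (k : ℕ) (x : E3) :
    iteratedFDeriv ℝ k (fun y => u y + t • w y) x = iteratedFDeriv ℝ k u x + t • iteratedFDeriv ℝ k w x := by
  have hu' : ContDiff ℝ k u := hu.of_le (by exact_mod_cast le_top)
  have hw' : ContDiff ℝ k w := hw.of_le (by exact_mod_cast le_top)
  have htw : ContDiff ℝ k (t • w) := hw'.const_smul t
  have h : (fun y => u y + t • w y) = u + t • w := rfl
  rw [h, iteratedFDeriv_add_apply hu'.contDiffAt htw.contDiffAt, iteratedFDeriv_const_smul_apply hw'.contDiffAt]

/-- **Core lemma** (the statement of `stub_nullTransfer` with the jet map `J` pinned by its defining equation and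
the properties of `b` as hypotheses). If `n ∘ J w` is the divergence of `F ∘ J w` for every smooth divergence-free
`w`, `v` is a divergence-free Schwartz field and `b` is a smooth divergence-free field with `(1+|x|)⁻⁴`-decaying
jets of order `≤ 4`, then `∫ Dn(J v x)[J b x] dx = 0`: `t ↦ ∫ n(J v x + t J b x) dx` vanishes identically
(`J(v + t b) = J v + t J b`, the hypothesis, and `∫ div = 0` by `StubFluxTransfer.flux`), and its derivative at
`t = 0` is the claimed integral (differentiation under the integral sign, dominated by `M C (1+|x|)⁻⁴`). -/
theorem integral_fderiv_eq_zero (J : (E3 → E3) → E3 → Jet3)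
    (hJ : ∀ u x, J u x = (u x, iteratedFDeriv ℝ 1 u x, iteratedFDeriv ℝ 2 u x, iteratedFDeriv ℝ 3 u x))
    {n : Jet3 → ℝ} {F : Jet3 → E3} (hn : ContDiff ℝ 1 n) (hF : ContDiff ℝ 1 F)
    (hyp : ∀ w : E3 → E3, ContDiff ℝ (⊤ : ℕ∞) w → VectorCalculus.IsDivFree w →
      ∀ x, n (J w x) = VectorCalculus.divergence (fun y => F (J w y)) x)
    {v b : E3 → E3} (hv : IsSchwartzField v) (hvd : VectorCalculus.IsDivFree v)
    (hb : ContDiff ℝ (⊤ : ℕ∞) b) (hbd : VectorCalculus.IsDivFree b)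
    (hdec : ∃ C : ℝ, ∀ k : ℕ, k ≤ 4 → ∀ x : E3, (1 + ‖x‖) ^ 4 * ‖iteratedFDeriv ℝ k b x‖ ≤ C) :
    ∫ x, fderiv ℝ n (J v x) (J b x) = 0 := by
  -- the jet spaces are finite-dimensional (hence proper)
  haveI := StubFluxTransfer.finiteDimensional_continuousMultilinearMap 1
  haveI := StubFluxTransfer.finiteDimensional_continuousMultilinearMap 2
  haveI := StubFluxTransfer.finiteDimensional_continuousMultilinearMap 3
  have hvs : ContDiff ℝ (⊤ : ℕ∞) v := ((isSchwartzField_iff v).1 hv).1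
  obtain ⟨A, hA⟩ := schwartz_decay_four hv
  obtain ⟨C, hC⟩ := hdec
  have eJ : ∀ u : E3 → E3,
      J u = fun x => (u x, iteratedFDeriv ℝ 1 u x, iteratedFDeriv ℝ 2 u x, iteratedFDeriv ℝ 3 u x) :=
    fun u => funext (hJ u)
  -- (1) POLARISE: the fields `w_t = v + t b` are smooth, divergence free, with jets `J v + t J b`
  have hws : ∀ t : ℝ, ContDiff ℝ (⊤ : ℕ∞) (fun y => v y + t • b y) := fun t => hvs.add (hb.const_smul t)
  have hwd : ∀ t : ℝ, VectorCalculus.IsDivFree (fun y => v y + t • b y) := fun t x => by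
    rw [divergence_add_smul (hvs.differentiable (by simp)) (hb.differentiable (by simp)) t x, hvd x, hbd x,
      mul_zero, add_zero]
  have hjet : ∀ (t : ℝ) (x : E3), J (fun y => v y + t • b y) x = J v x + t • J b x := fun t x => by
    rw [hJ, hJ, hJ]
    simp only [Prod.mk_add_mk, Prod.smul_mk, iteratedFDeriv_add_smul hvs hb]
  have hwdec : ∀ (t : ℝ) (k : ℕ), k ≤ 4 → ∀ x : E3,
      (1 + ‖x‖) ^ 4 * ‖iteratedFDeriv ℝ k (fun y => v y + t • b y) x‖ ≤ A + |t| * C := by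
    intro t k hk x
    rw [iteratedFDeriv_add_smul hvs hb]
    calc (1 + ‖x‖) ^ 4 * ‖iteratedFDeriv ℝ k v x + t • iteratedFDeriv ℝ k b x‖
        ≤ (1 + ‖x‖) ^ 4 * (‖iteratedFDeriv ℝ k v x‖ + |t| * ‖iteratedFDeriv ℝ k b x‖) := by
          gcongr
          calc ‖iteratedFDeriv ℝ k v x + t • iteratedFDeriv ℝ k b x‖
              ≤ ‖iteratedFDeriv ℝ k v x‖ + ‖t • iteratedFDeriv ℝ k b x‖ := norm_add_le _ _
            _ = ‖iteratedFDeriv ℝ k v x‖ + |t| * ‖iteratedFDeriv ℝ k b x‖ := by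
                rw [norm_smul, Real.norm_eq_abs]
      _ = (1 + ‖x‖) ^ 4 * ‖iteratedFDeriv ℝ k v x‖ + |t| * ((1 + ‖x‖) ^ 4 * ‖iteratedFDeriv ℝ k b x‖) := by
          ring
      _ ≤ A + |t| * C := add_le_add (hA k hk x) (mul_le_mul_of_nonneg_left (hC k hk x) (abs_nonneg t))
  -- (2) INTEGRATE: `∫ div F(J w_t) = 0`, hence `∫ n (J v + t J b) = 0` for every `t`
  have hflux : ∀ t : ℝ,
      Integrable (fun x => VectorCalculus.divergence (fun y => F (J (fun y => v y + t • b y) y)) x) ∧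
        ∫ x, VectorCalculus.divergence (fun y => F (J (fun y => v y + t • b y) y)) x = 0 := by
    intro t
    obtain ⟨h1, h0, hD⟩ := StubFluxTransfer.jet_bounds (hws t) (hwdec t)
    have h := StubFluxTransfer.flux h1 h0 hD hF
    rw [eJ]
    exact h
  have hInt : ∀ t : ℝ, Integrable (fun x => n (J v x + t • J b x)) ∧ ∫ x, n (J v x + t • J b x) = 0 := by
    intro t
    have hpt : ∀ x, n (J v x + t • J b x) =
        VectorCalculus.divergence (fun y => F (J (fun y => v y + t • b y) y)) x := fun x => by
      rw [← hjet t x]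
      exact hyp _ (hws t) (hwd t) x
    obtain ⟨hi, h0⟩ := hflux t
    refine ⟨hi.congr (Filter.Eventually.of_forall fun x => (hpt x).symm), ?_⟩
    rw [integral_congr_ae (Filter.Eventually.of_forall hpt)]
    exact h0
  -- (3) DIFFERENTIATE under the integral sign at `t = 0`
  obtain ⟨hv1, hvJ, -⟩ := StubFluxTransfer.jet_bounds hvs hA
  obtain ⟨hb1, hbJ, -⟩ := StubFluxTransfer.jet_bounds hb hC
  have hvJ' : ∀ x, ‖J v x‖ ≤ A * ((1 + ‖x‖) ^ 4)⁻¹ := fun x => by rw [hJ]; exact hvJ x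
  have hbJ' : ∀ x, ‖J b x‖ ≤ C * ((1 + ‖x‖) ^ 4)⁻¹ := fun x => by rw [hJ]; exact hbJ x
  obtain ⟨-, hvA⟩ := StubFluxTransfer.nonneg_of_decay hvJ'
  obtain ⟨-, hbC⟩ := StubFluxTransfer.nonneg_of_decay hbJ'
  have hcv : Continuous (J v) := by rw [eJ]; exact hv1.continuous
  have hcb : Continuous (J b) := by rw [eJ]; exact hb1.continuous
  obtain ⟨M, hM⟩ := (isCompact_closedBall (0 : Jet3) (A + C)).exists_bound_of_continuousOn
    (hn.continuous_fderiv one_ne_zero).continuousOn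
  have hball : ∀ t ∈ ball (0 : ℝ) 1, ∀ x, J v x + t • J b x ∈ closedBall (0 : Jet3) (A + C) := by
    intro t ht x
    rw [mem_ball, dist_zero_right] at ht
    rw [mem_closedBall, dist_zero_right]
    calc ‖J v x + t • J b x‖ ≤ ‖J v x‖ + ‖t • J b x‖ := norm_add_le _ _
      _ = ‖J v x‖ + ‖t‖ * ‖J b x‖ := by rw [norm_smul]
      _ ≤ A + 1 * C := add_le_add (hvA x) (mul_le_mul ht.le (hbC x) (norm_nonneg _) zero_le_one)
      _ = A + C := by ring
  have hM0 : 0 ≤ M := (norm_nonneg _).trans (hM _ (hball 0 (mem_ball_self one_pos) 0))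
  have hline : ∀ (x : E3) (t : ℝ), HasDerivAt (fun s : ℝ => J v x + s • J b x) (J b x) t := fun x t => by
    have h := ((hasDerivAt_id' t).smul_const (J b x)).const_add (J v x)
    rwa [one_smul] at h
  have key := hasDerivAt_integral_of_dominated_loc_of_deriv_le (μ := volume)
    (F := fun (t : ℝ) (x : E3) => n (J v x + t • J b x))
    (F' := fun (t : ℝ) (x : E3) => fderiv ℝ n (J v x + t • J b x) (J b x)) (x₀ := (0 : ℝ))
    (bound := fun x => M * (C * ((1 + ‖x‖) ^ 4)⁻¹)) (ball_mem_nhds (0 : ℝ) one_pos)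
    (Filter.Eventually.of_forall fun t =>
      (hn.continuous.comp (hcv.add (hcb.const_smul t))).aestronglyMeasurable)
    (hInt 0).1
    ((((hn.continuous_fderiv one_ne_zero).comp (hcv.add (hcb.const_smul (0 : ℝ)))).clm_apply
      hcb).aestronglyMeasurable)
    (Filter.Eventually.of_forall fun x t ht =>
      calc ‖fderiv ℝ n (J v x + t • J b x) (J b x)‖ ≤ ‖fderiv ℝ n (J v x + t • J b x)‖ * ‖J b x‖ :=
            ContinuousLinearMap.le_opNorm _ _
        _ ≤ M * (C * ((1 + ‖x‖) ^ 4)⁻¹) := mul_le_mul (hM _ (hball t ht x)) (hbJ' x) (norm_nonneg _) hM0)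
    ((StubFluxTransfer.integrable_inv_one_add_norm_pow.const_mul C).const_mul M)
    (Filter.Eventually.of_forall fun x t _ =>
      ((hn.differentiable one_ne_zero) _).hasFDerivAt.comp_hasDerivAt t (hline x t))
  have hzero : (fun t : ℝ => ∫ x, n (J v x + t • J b x)) = fun _ => 0 := funext fun t => (hInt t).2
  have hd := key.2
  rw [hzero] at hd
  have h := hd.unique (hasDerivAt_const (0 : ℝ) (0 : ℝ))
  -- `J v + 0 • J b = J v` (through `hjet`, as `v + 0 • b = v`)
  have h0 : ∀ x, J v x + (0 : ℝ) • J b x = J v x := fun x => by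
    rw [← hjet 0 x]
    simp only [zero_smul, add_zero]
  simp_rw [h0] at h
  exact h

end NullTransfer

/-- **`stub_nullTransfer`** (stub of the skeleton of the crux `OddMorawetz.MorawetzKillsTypeI`,
stmt-NavierStokesRegularity-1377, line `registered`). **Total divergences have vanishing Euler derivative.** If a
smooth density `n` on 3-jets is, along every smooth divergence-free field `w`, the divergence of a smooth flux of
the 3-jet, `n(Jw x) = div_x F(Jw ·)(x)`, then `∫ Dn(Jv)[J B(v,v)] = 0` for every divergence-free Schwartz `v`:
polarise along `w_t = v + t B(v,v)` (`B(v,v)` is smooth with decaying jets and divergence free: `stub_jetDecay`,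
`stub_divFree_eulerBilinear`), integrate (`∫ div = 0`, the flux lemma of `stub_fluxTransfer`) and differentiate
under the integral sign at `t = 0` (`NullTransfer.integral_fderiv_eq_zero`). -/
theorem stub_nullTransfer :
    ∀ (n : Jet3 → ℝ) (F : Jet3 → E3),
      let J := fun (v : E3 → E3) (x : E3) => ((v x, iteratedFDeriv ℝ 1 v x, iteratedFDeriv ℝ 2 v x, iteratedFDeriv ℝ 3 v x) : Jet3);
      ContDiff ℝ (⊤ : ℕ∞) n → ContDiff ℝ (⊤ : ℕ∞) F →
      (∀ w : E3 → E3, ContDiff ℝ (⊤ : ℕ∞) w → Literature.Analysis.FluidPDE.VectorCalculus.IsDivFree w →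
        ∀ x, n (J w x) = Literature.Analysis.FluidPDE.VectorCalculus.divergence (fun y => F (J w y)) x) →
      ∀ v, Literature.Analysis.FluidPDE.IsSchwartzField v → Literature.Analysis.FluidPDE.VectorCalculus.IsDivFree v →
        ∫ x, fderiv ℝ n (J v x) (J (Literature.Analysis.FluidPDE.eulerBilinear v v) x) = 0 := by
  intro n F J hn hF hyp v hv hd
  exact NullTransfer.integral_fderiv_eq_zero J (fun _ _ => rfl) (hn.of_le (by exact_mod_cast le_top))
    (hF.of_le (by exact_mod_cast le_top)) hyp hv hd (stub_jetDecay v hv hd).1 (stub_divFree_eulerBilinear v hv hd)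
    (stub_jetDecay v hv hd).2

end Summit.NavierStokesRegularity.NavierStokesRegularity.Theorems

end
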